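import Summits.BirchSwinnertonDyer.Rank1Residual.Additive.PotentiallyOrdinaryThree
import HarnessLib

/-!
# At `p = 3`: ordinary/supersingular read off `j` — `GoodOrd W 3`, `GoodSS W 3`, the twist, and the non-(G) additive pairs

HONEST FRAMING (cell `b2b-bsdres`, run/shared/lean/b2b/bsd-rank1-residual/, verbatim in every
file): the goal of the cell is to DELETE the COMBINATION-SHAPED residual classes of the
Birch–Swinnerton-Dyer formula for ALL analytic-rank `≤ 1` elliptic curves over `ℚ` — "full BSD
formula for every rank `≤ 1` curve in class `C`" assembled STRICTLY from published theorems — so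
that the rank-`≤ 1` remainder becomes exactly the CONSTRUCTION-SHAPED classes, which are TYPED
(missing-input `Prop`s), NOT attempted. This is not "finishing BSD". Sub-cell `additive-p2`
(X3♯(G-ord)/X4♯(G-ord): additive `p`, potentially good ORDINARY), generation 10: research route;
no claim beyond the stated classes; theorems only, no definition, no named fact;
labels / census / located gap UNCHANGED.

WHAT THIS FILE DOES. Consumer-facing corollaries of Deuring in characteristic `3`
(`DeuringThree.lean`) and of the datum-free dictionary at `p = 3` (`PotentiallyOrdinaryThree.lean`),
in the vocabulary the other seats use (`Rank1Residual.Predicates`: `Good`, `GoodOrd`, `GoodSS`,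
`frobeniusTrace`; X7/X8 are `GoodSS`-classes, X3♯/X4♯(G-ord) at `3` read the twist `E^{(−3)}`):

* `three_dvd_frobeniusTrace_iff_dvd_c₄` — for a globally minimal `W` GOOD at `3`:
  `3 ∣ a₃(W) ↔ 3 ∣ c₄(integralModelInt W)` (Deuring on the reduction mod `3`; `j̃ = 0 ⟺ c̃₄ = 0`);
  `three_dvd_c₄_iff_padicValRat_j` (`3 ∤ Δ_min`: `3 ∣ c₄ ↔ j = 0 ∨ ord₃ j > 0`);
* **`goodSS_three_iff_j`**: `GoodSS W 3 ↔ Good W 3 ∧ (j = 0 ∨ ord₃ j > 0)` and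
  **`goodOrd_three_iff_j`**: `GoodOrd W 3 ↔ Good W 3 ∧ j ≠ 0 ∧ ord₃ j = 0` — supersingular /
  ordinary at a GOOD prime `3` is read off `j` (no point count);
* `not_hasUnitRootAt_baseChange_three_of_padicValRat_j` — `3 ∣ j` (or `j = 0`) ⟹ SUPERSINGULAR at
  every good place above `3` of every number field (any `E/ℚ`);
* `typeG_three_of_good_unitRoot_baseChange`, **`not_hasUnitRootAt_baseChange_of_not_typeG_three`**
  — an ADDITIVE pair at `3` that is NOT of Delbourgo type (G) is potentially SUPERSINGULAR at every
  good place above `3` of every number field (the `p = 3` twin of gen 9's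
  `SubTprime.not_hasUnitRootAt_baseChange`);
* `goodOrd_twist_three_iff_j` — for `E` additive at `3` and any globally minimal model `Wd` of
  `E^{(−3)}`: `GoodOrd Wd 3 ↔ (j(E) ≠ 0 ∧ ord₃ j(E) = 0)` (gen 7's `typeGOrd_three_iff_goodOrd_twist`
  made datum-free).

References: M. Deuring (1941); J. H. Silverman, *AEC* V.4.1, VII.5; D. Delbourgo, Compositio
Math. 113 (1998) §1.5.
-/

noncomputable section

open scoped Classical NumberField

open WeierstrassCurve IsDedekindDomain IsDedekindDomain.HeightOneSpectrum NumberField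
  Literature.NumberTheory.EllipticCurves Literature.NumberTheory.EllipticCurves.Rank1Residual

namespace Summit.BirchSwinnertonDyer.Rank1Residual.Additive

section Frobenius

variable (W : WeierstrassCurve ℚ) [W.IsElliptic] [W.IsGloballyMinimal]

omit [W.IsElliptic] in
/-- **At a GOOD prime `3`: `3 ∣ a₃ ⟺ 3 ∣ c₄(minimal model)`** (the reduction mod `3` of the
integral minimal model is an elliptic curve over `𝔽₃`, supersingular iff `j̃ = 0` iff `c̃₄ = 0`;
`DeuringThree.ringChar_dvd_trace_iff_j_eq_zero_of_three`). Silverman *AEC* V.4.1. -/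
theorem three_dvd_frobeniusTrace_iff_dvd_c₄ (hgood : W.HasGoodReductionAtPrime 3) :
    (3 : ℤ) ∣ W.frobeniusTrace 3 ↔ (3 : ℤ) ∣ (integralModelInt W).c₄ := by
  have hΔ : ¬ (3 : ℤ) ∣ minimalDiscriminantInt W := fun h ↦
    not_hasGoodReductionAtPrime_of_dvd_minimalDiscriminantInt W 3 (by exact_mod_cast h) hgood
  set E₃ := (integralModelInt W).map (Int.castRingHom (ZMod 3)) with hE₃
  haveI : E₃.IsElliptic := by
    refine ⟨isUnit_iff_ne_zero.mpr ?_⟩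
    rw [hE₃, map_Δ, eq_intCast, Ne, ZMod.intCast_zmod_eq_zero_iff_dvd]
    exact hΔ
  have hD := DeuringThree.ringChar_dvd_trace_iff_j_eq_zero_of_three E₃ (ZMod.ringChar_zmod_n 3)
  rw [ZMod.card] at hD
  have htr : W.frobeniusTrace 3 = ((3 : ℕ) : ℤ) + 1 - Nat.card E₃.toAffine.Point := rfl
  rw [htr, hD, j_eq_zero_iff, hE₃, map_c₄, eq_intCast, ZMod.intCast_zmod_eq_zero_iff_dvd]
  norm_cast

/-- With `3 ∤ Δ_min`: `3 ∣ c₄(minimal model) ⟺ (j = 0 ∨ ord₃ j > 0)` (`j = c₄³/Δ_min`). [folklore] -/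
theorem three_dvd_c₄_iff_padicValRat_j (hΔ : ¬ (3 : ℤ) ∣ minimalDiscriminantInt W) :
    (3 : ℤ) ∣ (integralModelInt W).c₄ ↔ (W.j = 0 ∨ 0 < padicValRat 3 W.j) := by
  haveI : Fact (Nat.Prime 3) := ⟨Nat.prime_three⟩
  have hc : W.c₄ = ((integralModelInt W).c₄ : ℚ) :=
    Summit.BirchSwinnertonDyer.BirchSwinnertonDyer.Rank1Residual.IntModel.c₄_eq_cast rfl
  have hΔ' : W.Δ = ((integralModelInt W).Δ : ℚ) :=
    Summit.BirchSwinnertonDyer.BirchSwinnertonDyer.Rank1Residual.IntModel.Δ_eq_cast rfl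
  have hΔ0 : (integralModelInt W).Δ ≠ 0 := minimalDiscriminantInt_ne_zero W
  have hvΔ : padicValInt 3 (integralModelInt W).Δ = 0 := padicValInt.eq_zero_of_not_dvd hΔ
  have hjq : W.j = W.c₄ ^ 3 / W.Δ := by
    rw [WeierstrassCurve.j, ← coe_Δ', div_eq_inv_mul, Units.val_inv_eq_inv_val]
  by_cases hc0 : (integralModelInt W).c₄ = 0
  · have hj : W.j = 0 := by rw [hjq, hc, hc0]; simp
    simp [hc0, hj]
  · have hj0 : W.j ≠ 0 := by
      rw [hjq, hc, hΔ']
      exact div_ne_zero (pow_ne_zero _ (by exact_mod_cast hc0)) (by exact_mod_cast hΔ0)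
    have hv : padicValRat 3 W.j = 3 * padicValInt 3 (integralModelInt W).c₄ := by
      rw [hjq, hc, hΔ', padicValRat.div (pow_ne_zero _ (by exact_mod_cast hc0))
        (by exact_mod_cast hΔ0), padicValRat.pow, padicValRat.of_int, padicValRat.of_int, hvΔ]
      push_cast; ring
    have h1 : (3 : ℤ) ∣ (integralModelInt W).c₄ ↔
        (integralModelInt W).c₄ = 0 ∨ 1 ≤ padicValInt 3 (integralModelInt W).c₄ := by
      simpa using three_pow_dvd_iff 1 (integralModelInt W).c₄
    rw [h1, hv]
    constructor
    · rintro (h | h)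
      · exact absurd h hc0
      · right; omega
    · rintro (h | h)
      · exact absurd h hj0
      · right; omega

/-- **Supersingular at a good prime `3` ⟺ `3 ∣ j`**: `GoodSS W 3 ↔ Good W 3 ∧ (j = 0 ∨ ord₃ j > 0)`
(globally minimal `W`; `GoodSS = Good ∧ 3 ∣ a₃`). The X7/X8 rows at `p = 3` are read off `j`. -/
theorem goodSS_three_iff_j [Fact (Nat.Prime 3)] :
    GoodSS W 3 ↔ W.HasGoodReductionAtPrime 3 ∧ (W.j = 0 ∨ 0 < padicValRat 3 W.j) := by
  have key : ∀ hgood : W.HasGoodReductionAtPrime 3,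
      ((3 : ℤ) ∣ W.frobeniusTrace 3 ↔ (W.j = 0 ∨ 0 < padicValRat 3 W.j)) := fun hgood ↦
    (three_dvd_frobeniusTrace_iff_dvd_c₄ W hgood).trans (three_dvd_c₄_iff_padicValRat_j W
      (fun h ↦ not_hasGoodReductionAtPrime_of_dvd_minimalDiscriminantInt W 3
        (by exact_mod_cast h) hgood))
  constructor
  · rintro ⟨hgood, hdvd⟩
    have hdvd' : (3 : ℤ) ∣ W.frobeniusTrace 3 := by exact_mod_cast hdvd
    exact ⟨hgood, (key hgood).mp hdvd'⟩
  · rintro ⟨hgood, hj⟩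
    have h3 : (3 : ℤ) ∣ W.frobeniusTrace 3 := (key hgood).mpr hj
    exact ⟨hgood, by exact_mod_cast h3⟩

/-- **Ordinary at a good prime `3` ⟺ `j` is a `3`-adic unit**: `GoodOrd W 3 ↔ Good W 3 ∧ j ≠ 0 ∧
ord₃ j = 0` (globally minimal `W`; `GoodOrd = Good ∧ 3 ∤ a₃`; `ord₃ j ≥ 0` is automatic at a good
prime). -/
theorem goodOrd_three_iff_j [Fact (Nat.Prime 3)] :
    GoodOrd W 3 ↔ W.HasGoodReductionAtPrime 3 ∧ W.j ≠ 0 ∧ padicValRat 3 W.j = 0 := by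
  have key : ∀ hgood : W.HasGoodReductionAtPrime 3,
      ((3 : ℤ) ∣ W.frobeniusTrace 3 ↔ (W.j = 0 ∨ 0 < padicValRat 3 W.j)) := fun hgood ↦
    (three_dvd_frobeniusTrace_iff_dvd_c₄ W hgood).trans (three_dvd_c₄_iff_padicValRat_j W
      (fun h ↦ not_hasGoodReductionAtPrime_of_dvd_minimalDiscriminantInt W 3
        (by exact_mod_cast h) hgood))
  constructor
  · rintro ⟨hgood, hndvd⟩
    have hndvd' : ¬ (3 : ℤ) ∣ W.frobeniusTrace 3 := by exact_mod_cast hndvd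
    obtain ⟨hj0, hle⟩ := not_or.mp (fun h ↦ hndvd' ((key hgood).mpr h))
    -- `ord₃ j ≥ 0` at a good prime: place-indexed good reduction over `ℚ` itself
    set u₃ : HeightOneSpectrum (𝓞 ℚ) :=
      (Rat.HeightOneSpectrum.primesEquiv (R := 𝓞 ℚ)).symm ⟨3, Nat.prime_three⟩ with hu₃def
    have hu₃ : ((3 : ℕ) : 𝓞 ℚ) ∈ u₃.asIdeal :=
      (natCast_mem_asIdeal_iff_eq_primesEquiv_symm u₃ Nat.prime_three).mpr rfl
    have hgoodAt : (W.baseChange ℚ).HasGoodReductionAt u₃ := by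
      rw [show W.baseChange ℚ = W from W.map_id]
      exact hasGoodReductionAt_of_hasGoodReductionAtPrime 3 W hgood
    have hnn : 0 ≤ padicValRat 3 W.j :=
      padicValRat_j_nonneg_of_hasGoodReductionAt_baseChange W 3 hu₃ hgoodAt
    exact ⟨hgood, hj0, le_antisymm (not_lt.mp hle) hnn⟩
  · rintro ⟨hgood, hj0, hj⟩
    have h3 : ¬ (3 : ℤ) ∣ W.frobeniusTrace 3 := fun hdvd ↦ by
      rcases (key hgood).mp hdvd with h | h
      · exact hj0 h
      · exact absurd hj (ne_of_gt h)
    exact ⟨hgood, by exact_mod_cast h3⟩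

end Frobenius

section Everywhere

variable (W : WeierstrassCurve ℚ) [W.IsElliptic]

/-- **`3 ∣ j` (or `j = 0`) ⟹ SUPERSINGULAR at every good place above `3` of every number field**
(any `E/ℚ`): the reduction has `j̃ = 0` (`valuation_algebraMap_lt_one_of_padicValRat_pos`, gen 3)
and Deuring in characteristic `3` applies (`not_hasUnitRootAt_of_valuation_j_lt_one_three`). -/
theorem not_hasUnitRootAt_baseChange_three_of_padicValRat_j (hj : W.j = 0 ∨ 0 < padicValRat 3 W.j)
    {F : Type*} [Field F] [NumberField F] {w : HeightOneSpectrum (𝓞 F)}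
    (hw : ((3 : ℕ) : 𝓞 F) ∈ w.asIdeal) (hgood : (W.baseChange F).HasGoodReductionAt w) :
    ¬ (W.baseChange F).HasUnitRootAt w := by
  haveI : Fact (Nat.Prime 3) := ⟨Nat.prime_three⟩
  haveI : (W.baseChange F).IsElliptic := by rw [baseChange]; infer_instance
  have hjF : (W.baseChange F).j = algebraMap ℚ F W.j := W.map_j (algebraMap ℚ F)
  refine not_hasUnitRootAt_of_valuation_j_lt_one_three (W.baseChange F) w hw hgood ?_
  rw [hjF]
  exact valuation_algebraMap_lt_one_of_padicValRat_pos 3 w hw hj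

variable [W.IsGloballyMinimal]

/-- **Potentially good ORDINARY somewhere above `3` ⟹ Delbourgo's (G)** (`E` additive at `3`): the
`p = 3` twin of gen 9's `typeG_of_good_unitRoot_baseChange` (`j` is a `3`-adic unit by
`padicValRat_j_eq_zero_of_good_unitRoot_three`, then `typeG_three_of_padicValRat_j_eq_zero`). -/
theorem typeG_three_of_good_unitRoot_baseChange (hadd : Addv W 3) {F : Type*} [Field F]
    [NumberField F] {w : HeightOneSpectrum (𝓞 F)} (hw : ((3 : ℕ) : 𝓞 F) ∈ w.asIdeal)
    (hgood : (W.baseChange F).HasGoodReductionAt w) (hunit : (W.baseChange F).HasUnitRootAt w) :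
    TypeG W 3 := by
  obtain ⟨hj0, hj⟩ := padicValRat_j_eq_zero_of_good_unitRoot_three W w hw hgood hunit
  exact typeG_three_of_padicValRat_j_eq_zero W hadd hj0 hj

/-- **An additive pair at `3` NOT of type (G) is potentially SUPERSINGULAR everywhere**: at every
place `w ∋ 3` of every number field `F` where `E_F` is good, the unit-root condition FAILS. The
`p = 3` twin of gen 9's `SubTprime.not_hasUnitRootAt_baseChange` (at `p = 3` the non-(G) additive
potentially-good pairs are the wild ones and the tame ones of defect `4`; all have `3 ∣ j`). -/
theorem not_hasUnitRootAt_baseChange_of_not_typeG_three (hadd : Addv W 3) (hG : ¬ TypeG W 3)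
    {F : Type*} [Field F] [NumberField F] {w : HeightOneSpectrum (𝓞 F)}
    (hw : ((3 : ℕ) : 𝓞 F) ∈ w.asIdeal) (hgood : (W.baseChange F).HasGoodReductionAt w) :
    ¬ (W.baseChange F).HasUnitRootAt w := fun hunit ↦
  hG (typeG_three_of_good_unitRoot_baseChange W hadd hw hgood hunit)

/-- **The twist reading, datum-free**: for `E` additive at `3` and any globally minimal model `Wd`
of `E^{(−3)}`, `GoodOrd Wd 3 ↔ (j(E) ≠ 0 ∧ ord₃ j(E) = 0)` (gen 7's
`typeGOrd_three_iff_goodOrd_twist` + `typeGOrd_three_iff_padicValRat_j`). -/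
theorem goodOrd_twist_three_iff_j [Fact (Nat.Prime 3)] (hadd : Addv W 3) (Wd : WeierstrassCurve ℚ)
    [Wd.IsElliptic] [Wd.IsGloballyMinimal] (C : VariableChange ℚ)
    (hWd : C • W.quadraticTwist ((-1 : ℚ) ^ ((3 : ℕ) / 2) * (3 : ℕ)) = Wd) :
    GoodOrd Wd 3 ↔ W.j ≠ 0 ∧ padicValRat 3 W.j = 0 := by
  rw [← typeGOrd_three_iff_goodOrd_twist W hadd Wd C hWd, typeGOrd_three_iff_padicValRat_j W hadd]

end Everywhere

end Summit.BirchSwinnertonDyer.Rank1Residual.Additive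

end
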